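import Summits.Ventures.PercRepro.RankLevelSetFrameQ

/-!
# PercRepro — THE HYPERPLANE KEY: `C025` AT `(p, q)` FROM ONE BIG NON-SPANNING SET (p1, gen 42; a feeder of S2 / S3)

In an `e`-free matroid (every point `e` splits the rest of the ground set into two parts, neither of which spans `e`)
of rank `p` on `n` points, one of the two parts at any point has `≥ ⌈(n − 1)/2⌉ = ⌊n/2⌋` points and does not span
(`e` is outside its closure): every subset of it of rank `> q` lies in the middle level set `Y(p, q)`, so
`#Y(p, q) + #{ρ ≤ q} ≥ 2^{⌊n/2⌋}`, while `#U(p, q) ≤ #{ρ ≤ q}` (the complement map). Hence **`ThmN.RLS M p q`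
whenever `(Φ(p, q) + 1) · #{ρ ≤ q} ≤ 2^{⌊n/2⌋}`** — a key for the large-corank tails of every row, with the
rank-`≤ q` count as a bound hypothesis (the shape of p7's `c025_core_five_cell_direct`). Nothing about any cell is
claimed here; the numerals live in `HyperplaneKeyFive`.

* `eRk_lt_eRank_of_notMem_closure` — a set whose closure misses a point of `E` has rank `< ρ(E)`;
* `exists_nonspanning_half_of_free` — the big non-spanning part: `n ≤ 2·|H| + 1`;
* `two_pow_le_midCount_add_low` — `2^{|H|} ≤ #Y(p, q) + #{ρ ≤ q}` for a non-spanning `H`;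
* `two_pow_half_le_midCount_add_low` — the same with `|H|` replaced by `⌊n/2⌋` under `e`-freeness (empty `E` included);
* `topCount_le_low` — `#U(p, q) ≤ #{ρ ≤ q}`;
* `phiK_nonneg` — `0 ≤ Φ(p, q)`;
* **`rls_of_hyperplane_key`** — the key.
Axioms: standard.
-/

open scoped Matroid

namespace PercRepro

namespace HypKey

open Set

variable {α : Type}

/-- A subset of the ground set whose closure misses a point of the ground set has rank `< ρ(E)`. -/
theorem eRk_lt_eRank_of_notMem_closure (M : Matroid α) [M.Finite] {A : Set α} {e : α}
    (hA : A ⊆ M.E) (he : e ∈ M.E) (hcl : e ∉ M.closure A) : M.eRk A < M.eRank := by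
  by_contra h
  have h' : M.eRank ≤ M.eRk A := not_lt.1 h
  have hsp : M.Spanning A := (M.spanning_iff_eRk_le hA).2 h'
  exact hcl (by rw [(M.spanning_iff_closure_eq hA).1 hsp]; exact he)

/-- **The big non-spanning part.** In an `e`-free matroid with a nonempty ground set there is a subset `H` of `E`
of rank `< ρ(E)` with `|E| ≤ 2·|H| + 1`: at any point `e` one of the two parts of the partition of `E ∖ {e}`. -/
theorem exists_nonspanning_half_of_free (M : Matroid α) [M.Finite]
    (hfree : ∀ e ∈ M.E, ∃ A ⊆ M.E \ {e}, e ∉ M.closure A ∧ e ∉ M.closure ((M.E \ {e}) \ A))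
    (hne : M.E.Nonempty) :
    ∃ H ⊆ M.E, M.eRk H < M.eRank ∧ M.E.ncard ≤ 2 * H.ncard + 1 := by
  obtain ⟨e, he⟩ := hne
  obtain ⟨A, hA, heA, heB⟩ := hfree e he
  have hEfin : M.E.Finite := M.ground_finite
  have hAE : A ⊆ M.E := hA.trans sdiff_subset
  have hBE : (M.E \ {e}) \ A ⊆ M.E := sdiff_subset.trans sdiff_subset
  have h1 : (M.E \ {e}).ncard + 1 = M.E.ncard := ncard_sdiff_singleton_add_one he hEfin
  have h2 : ((M.E \ {e}) \ A).ncard + A.ncard = (M.E \ {e}).ncard :=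
    ncard_sdiff_add_ncard_of_subset hA (hEfin.sdiff)
  rcases Nat.lt_or_ge A.ncard ((M.E \ {e}) \ A).ncard with hlt | hle
  · exact ⟨(M.E \ {e}) \ A, hBE, eRk_lt_eRank_of_notMem_closure M hBE he heB, by omega⟩
  · exact ⟨A, hAE, eRk_lt_eRank_of_notMem_closure M hAE he heA, by omega⟩

/-- **`2^{|H|} ≤ #Y(p, q) + #{ρ ≤ q}`** for a non-spanning `H ⊆ E` when `ρ(E) = p`: every subset of `H` has rank
`< p`, and it is in `Y` unless its rank is `≤ q`. -/
theorem two_pow_le_midCount_add_low (M : Matroid α) [M.Finite] (p q : ℕ) (hR : M.eRank = (p : ℕ∞))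
    {H : Set α} (hH : H ⊆ M.E) (hHr : M.eRk H < M.eRank) :
    2 ^ H.ncard ≤ Matroid.midCount M p q + {X : Set α | X ⊆ M.E ∧ M.eRk X ≤ (q : ℕ∞)}.ncard := by
  have hHfin : H.Finite := M.ground_finite.subset hH
  have hsplit : 𝒫 H ⊆ {A : Set α | A ⊆ M.E ∧ (q : ℕ∞) < M.eRk A ∧ M.eRk A < (p : ℕ∞)} ∪
      {X : Set α | X ⊆ M.E ∧ M.eRk X ≤ (q : ℕ∞)} := by
    intro X hX
    have hXH : X ⊆ H := hX
    have hXE : X ⊆ M.E := hXH.trans hH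
    by_cases hq : M.eRk X ≤ (q : ℕ∞)
    · exact Or.inr ⟨hXE, hq⟩
    · refine Or.inl ⟨hXE, lt_of_not_ge hq, ?_⟩
      calc M.eRk X ≤ M.eRk H := M.eRk_mono hXH
        _ < M.eRank := hHr
        _ = (p : ℕ∞) := hR
  have hfin : ({A : Set α | A ⊆ M.E ∧ (q : ℕ∞) < M.eRk A ∧ M.eRk A < (p : ℕ∞)} ∪
      {X : Set α | X ⊆ M.E ∧ M.eRk X ≤ (q : ℕ∞)}).Finite :=
    (M.ground_finite.finite_subsets.subset (fun X hX => hX.1)).union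
      (M.ground_finite.finite_subsets.subset (fun X hX => hX.1))
  unfold Matroid.midCount
  calc 2 ^ H.ncard = (𝒫 H).ncard := (ncard_powerset H hHfin).symm
    _ ≤ ({A : Set α | A ⊆ M.E ∧ (q : ℕ∞) < M.eRk A ∧ M.eRk A < (p : ℕ∞)} ∪
        {X : Set α | X ⊆ M.E ∧ M.eRk X ≤ (q : ℕ∞)}).ncard := ncard_le_ncard hsplit hfin
    _ ≤ _ := ncard_union_le _ _

/-- **`2^{⌊n/2⌋} ≤ #Y(p, q) + #{ρ ≤ q}`** in an `e`-free matroid of rank `p` on `n` points (the empty ground set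
included: then `∅` is a rank-`0` set). -/
theorem two_pow_half_le_midCount_add_low (M : Matroid α) [M.Finite] (p q : ℕ) (hR : M.eRank = (p : ℕ∞))
    (hfree : ∀ e ∈ M.E, ∃ A ⊆ M.E \ {e}, e ∉ M.closure A ∧ e ∉ M.closure ((M.E \ {e}) \ A)) :
    2 ^ (M.E.ncard / 2) ≤ Matroid.midCount M p q + {X : Set α | X ⊆ M.E ∧ M.eRk X ≤ (q : ℕ∞)}.ncard := by
  rcases M.E.eq_empty_or_nonempty with hE | hne
  · have h0 : M.E.ncard = 0 := by rw [hE, ncard_empty]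
    rw [h0]
    have hmem : (∅ : Set α) ∈ {X : Set α | X ⊆ M.E ∧ M.eRk X ≤ (q : ℕ∞)} := by
      refine ⟨empty_subset _, ?_⟩
      rw [M.eRk_empty]
      exact zero_le
    have hpos : 1 ≤ {X : Set α | X ⊆ M.E ∧ M.eRk X ≤ (q : ℕ∞)}.ncard :=
      (ncard_pos (M.ground_finite.finite_subsets.subset (fun X hX => hX.1))).2 ⟨∅, hmem⟩
    simp only [Nat.zero_div, pow_zero]
    omega
  · obtain ⟨H, hH, hHr, hcard⟩ := exists_nonspanning_half_of_free M hfree hne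
    calc 2 ^ (M.E.ncard / 2) ≤ 2 ^ H.ncard :=
          Nat.pow_le_pow_right (by norm_num) (by omega)
      _ ≤ _ := two_pow_le_midCount_add_low M p q hR hH hHr

/-- **`#U(p, q) ≤ #{ρ ≤ q}`**: the complement `E ∖ A` of a top set has rank `q`, and `A ↦ E ∖ A` is injective on
subsets of `E`. -/
theorem topCount_le_low (M : Matroid α) [M.Finite] (p q : ℕ) :
    Matroid.topCount M p q ≤ {X : Set α | X ⊆ M.E ∧ M.eRk X ≤ (q : ℕ∞)}.ncard := by
  unfold Matroid.topCount
  refine ncard_le_ncard_of_injOn (fun A => M.E \ A) ?_ ?_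
    (M.ground_finite.finite_subsets.subset (fun X hX => hX.1))
  · rintro A ⟨-, -, hAc⟩
    exact ⟨sdiff_subset, le_of_eq hAc⟩
  · rintro A ⟨hA, -, -⟩ A' ⟨hA', -, -⟩ h
    simp only at h
    rw [← sdiff_sdiff_cancel_left hA, h, sdiff_sdiff_cancel_left hA']

/-- `0 ≤ Φ(p, q)`. -/
theorem phiK_nonneg (p q : ℕ) : 0 ≤ phiK p q := by
  unfold phiK
  exact div_nonneg (Finset.sum_nonneg (fun u _ => Nat.cast_nonneg _)) (Nat.cast_nonneg _)

/-- **THE HYPERPLANE KEY.** `e`-free, `ρ(E) = p`, `#{ρ ≤ q} ≤ A` and `(Φ(p, q) + 1) · A ≤ 2^{⌊n/2⌋}` give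
`ThmN.RLS M p q`: `Φ · #U ≤ Φ · A = (Φ + 1) · A − A ≤ 2^{⌊n/2⌋} − A ≤ #Y + #{ρ ≤ q} − A ≤ #Y`. -/
theorem rls_of_hyperplane_key (M : Matroid α) [M.Finite] (p q : ℕ) (hR : M.eRank = (p : ℕ∞))
    (hfree : ∀ e ∈ M.E, ∃ A ⊆ M.E \ {e}, e ∉ M.closure A ∧ e ∉ M.closure ((M.E \ {e}) \ A))
    (A : ℚ) (hA : ({X : Set α | X ⊆ M.E ∧ M.eRk X ≤ (q : ℕ∞)}.ncard : ℚ) ≤ A)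
    (hkey : (phiK p q + 1) * A ≤ (2 : ℚ) ^ (M.E.ncard / 2)) : ThmN.RLS M p q := by
  rw [ThmN.RLS_iff]
  have hΦ := phiK_nonneg p q
  have hT := topCount_le_low M p q
  have hY := two_pow_half_le_midCount_add_low M p q hR hfree
  have hTq : (Matroid.topCount M p q : ℚ) ≤
      ({X : Set α | X ⊆ M.E ∧ M.eRk X ≤ (q : ℕ∞)}.ncard : ℚ) := by exact_mod_cast hT
  have hYq : (2 : ℚ) ^ (M.E.ncard / 2) ≤ (Matroid.midCount M p q : ℚ) +
      ({X : Set α | X ⊆ M.E ∧ M.eRk X ≤ (q : ℕ∞)}.ncard : ℚ) := by exact_mod_cast hY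
  have h1 : phiK p q * (Matroid.topCount M p q : ℚ) ≤ phiK p q * A :=
    mul_le_mul_of_nonneg_left (hTq.trans hA) hΦ
  nlinarith [h1, hkey, hYq, hA]

end HypKey

end PercRepro
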